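import Mathlib
import Literature.Computability.AlgebraicComplexity.Hyperdeterminant
import Summits.ValiantsHypothesis.ValiantsHypothesis.Theorems.BorderApolarityBorelFixedBorderApolarityWeightsA
import Summits.ValiantsHypothesis.ValiantsHypothesis.Theorems.BorderApolarityFixedWitnessObstructionQPH0Elementary
import Summits.ValiantsHypothesis.ValiantsHypothesis.Theorems.DetQPDetqpThesisStubWeightHAux

/-!
# `DetqpThesis` (stmt-ValiantsHypothesis-0315), line `four-dimensional-determinant` — stub B2w:
# a generic anti-dominant cocharacter of the torus of `H(n,m,ι)`

Crux `Summit.ValiantsHypothesis.ValiantsHypothesis.Theses.DetQP.DetqpThesis`, line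
`four-dimensional-determinant`, registered stub `stub_weightH` (B2w).  The `n⁴` array variables
`I : Fin 4 → Fin n` are placed injectively by `ι` among the `m²` matrix variables `Fin m × Fin m`,
missing the padding variable `(0,0)`; the remaining variables `p ∉ range ι`, `p ≠ (0,0)` are
"unused".  We build an integer weight `μ` on `Fin m × Fin m` with

0. `μ ≥ 0`;
1. `μ` injective;
2. anti-dominance: lowering an index inside the used block RAISES `μ`; unused variables weigh less
   than used ones and than the padding variable; among unused variables `μ` decreases with the
   position `p.1 m + p.2`;
3. the padded four-dimensional determinant `X₀₀^{m-n} · rename ι (hyperdet X)` is `μ`-homogeneous;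
4. genericity: two exponents of degree `≤ m` with the same `μ`-weight have the same character
   `∏_v d_v^{e_v}` for every nowhere-zero `d` which is a tensor product `d(ιI) = ∏_r t_r(I_r)` on
   the used block;
5. weights of exponents of degree `≤ m` are bounded.

Construction (mirror of the per-analogue `bfba_exists_weight`, route BorderApolarity): base
`R = 4m + 5`, `L = m²`; four "slot digit" positions `g r i = L + 4 (n-1-i) + r` (`r : Fin 4`,
`i : Fin n`), the padding position `L + 4n`, and the positions `L - 1 - (p.1 m + p.2)` of the unused
variables; `μ_v = Σ_r R^{G r v}` where `G r (ιI) = g r (I r)`, `G r (0,0) = L + 4n`,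
`G r p = L - 1 - (p.1 m + p.2)`.  The weight of a monomial of degree `≤ m` is then a base-`R`
numeral whose digits (all `≤ 4m < R`) are `4 e₀₀`, `4 e_p` (unused `p`) and the slot contents
`Σ_{I_r = i} e_{ιI}`; digits are unique (`bfba_digits_inj`), and the character of a tensor-product
diagonal only depends on these contents (`DetQPDetqpThesisStubWeightHAux`).  Folklore arithmetic;
no `n ≥ 1` or `n ≤ m` is needed.
-/

noncomputable section
set_option linter.dupNamespace false

namespace Summit.ValiantsHypothesis.ValiantsHypothesis.Theorems.DetQPDetqpThesis

open Literature.Computability.AlgebraicComplexity MvPolynomial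
open scoped BigOperators
open Summit.ValiantsHypothesis.ValiantsHypothesis.Theorems.BorderApolarityBorelFixedBorderApolarity
open Summit.ValiantsHypothesis.ValiantsHypothesis.Theorems.BorderApolarityFixedWitnessObstructionQP
  (fst_mul_add_snd_lt)

/-- **Stub B2w — a generic anti-dominant cocharacter of the torus of `H(n,m,ι)`** with the
properties (0)–(5) of the module docstring: nonnegative, injective, anti-dominant (index-lowering
inside the used block and the moves of unused variables change `μ` in the stated directions),
the padded four-dimensional determinant `X₀₀^{m-n} · H_n(X_ι)` is `μ`-homogeneous, equal `μ`-weight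
in degree `≤ m` forces equal character for every tensor-product diagonal, and boundedness.
[folklore] -/
theorem stub_weightH (n m : ℕ) [NeZero m]
    (ι : (Fin 4 → Fin n) → Fin m × Fin m) (hι : Function.Injective ι)
    (hℓ : ((0 : Fin m), (0 : Fin m)) ∉ Set.range ι) :
    ∃ μ : Fin m × Fin m → ℤ,
      (∀ v, 0 ≤ μ v) ∧
      Function.Injective μ ∧
      (∀ I I' : Fin 4 → Fin n, (∀ r, I' r ≤ I r) → I ≠ I' → μ (ι I) < μ (ι I')) ∧
      (∀ p : Fin m × Fin m, p ∉ Set.range ι → p ≠ (0, 0) → ∀ I : Fin 4 → Fin n, μ p < μ (ι I)) ∧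
      (∀ p : Fin m × Fin m, p ∉ Set.range ι → p ≠ (0, 0) → μ p < μ (0, 0)) ∧
      (∀ p q : Fin m × Fin m, p ∉ Set.range ι → p ≠ (0, 0) → q ∉ Set.range ι → q ≠ (0, 0) →
        (p.1 : ℕ) * m + (p.2 : ℕ) < (q.1 : ℕ) * m + (q.2 : ℕ) → μ q < μ p) ∧
      (∃ ν₀ : ℤ, ∀ d ∈ (X ((0 : Fin m), (0 : Fin m)) ^ (m - n) *
          rename ι (hyperdet fun I : Fin 4 → Fin n => (X I : MvPolynomial (Fin 4 → Fin n) ℂ))).support,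
        Finsupp.weight μ d = ν₀) ∧
      (∀ e e' : Fin m × Fin m →₀ ℕ, e.degree ≤ m → e'.degree ≤ m →
        Finsupp.weight μ e = Finsupp.weight μ e' →
        ∀ d : Fin m × Fin m → ℂ, (∀ v, d v ≠ 0) →
          (∃ t : Fin 4 → Fin n → ℂ, ∀ I : Fin 4 → Fin n, d (ι I) = ∏ r, t r (I r)) →
          ∏ v ∈ e.support, d v ^ e v = ∏ v ∈ e'.support, d v ^ e' v) ∧
      (∃ hi : ℤ, ∀ e : Fin m × Fin m →₀ ℕ, e.degree ≤ m → Finsupp.weight μ e ≤ hi) := by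
  classical
  have hm : 1 ≤ m := NeZero.one_le
  -- notation
  set L : ℕ := m * m with hL
  set R : ℕ := 4 * m + 5 with hR
  have hR1 : 1 < R := by omega
  have hR0 : 0 < R := by omega
  have hL1 : 1 ≤ L := by rw [hL]; exact Nat.mul_pos hm hm
  set lin : Fin m × Fin m → ℕ := fun v => (v.1 : ℕ) * m + (v.2 : ℕ) with hlin
  have hlinL : ∀ v, lin v < L := fun v => fst_mul_add_snd_lt v
  set g : Fin 4 → Fin n → ℕ := fun r i => L + 4 * (n - 1 - (i : ℕ)) + (r : ℕ) with hg
  set G : Fin 4 → Fin m × Fin m → ℕ := fun r =>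
    Function.extend ι (fun I => g r (I r))
      (fun v => if v = (0, 0) then L + 4 * n else L - 1 - lin v) with hG
  set μn : Fin m × Fin m → ℕ := fun v => ∑ r, R ^ G r v with hμn
  set Q : ℕ := L + 4 * n + 1 with hQ
  -- the values of `G` and `μn`
  have hGι : ∀ r I, G r (ι I) = g r (I r) := fun r I => hι.extend_apply _ _ I
  have hG0 : ∀ r, G r (0, 0) = L + 4 * n := by
    intro r
    simp only [hG]
    rw [Function.extend_apply' _ _ _ hℓ, if_pos rfl]
  have hGp : ∀ r p, p ∉ Set.range ι → p ≠ (0, 0) → G r p = L - 1 - lin p := by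
    intro r p hp hp0
    simp only [hG]
    rw [Function.extend_apply' _ _ _ hp, if_neg hp0]
  have hGval : ∀ r v, (∃ I, v = ι I ∧ G r v = g r (I r)) ∨ (v = (0, 0) ∧ G r v = L + 4 * n) ∨
      (v ∉ Set.range ι ∧ v ≠ (0, 0) ∧ G r v = L - 1 - lin v) := by
    intro r v
    by_cases hv : v ∈ Set.range ι
    · obtain ⟨I, rfl⟩ := hv
      exact Or.inl ⟨I, rfl, hGι r I⟩
    by_cases hv0 : v = (0, 0)
    · exact Or.inr (Or.inl ⟨hv0, hv0 ▸ hG0 r⟩)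
    exact Or.inr (Or.inr ⟨hv, hv0, hGp r v hv hv0⟩)
  have hμnι : ∀ I, μn (ι I) = ∑ r, R ^ g r (I r) := by
    intro I
    simp only [hμn, hGι]
  have hμn0 : μn (0, 0) = 4 * R ^ (L + 4 * n) := by
    simp only [hμn, hG0, Finset.sum_const, Finset.card_univ, Fintype.card_fin, smul_eq_mul]
  have hμnp : ∀ p, p ∉ Set.range ι → p ≠ (0, 0) → μn p = 4 * R ^ (L - 1 - lin p) := by
    intro p hp hp0
    simp only [hμn, hGp _ p hp hp0, Finset.sum_const, Finset.card_univ, Fintype.card_fin,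
      smul_eq_mul]
  have hgQ : ∀ r i, g r i < L + 4 * n := by
    intro r i
    have := i.isLt
    have := r.isLt
    simp only [hg]
    omega
  have hGQ : ∀ r v, G r v < Q := by
    intro r v
    rcases hGval r v with ⟨I, rfl, h⟩ | ⟨rfl, h⟩ | ⟨-, -, h⟩
    · rw [h]; have := hgQ r (I r); omega
    · rw [h]; omega
    · rw [h]; have := hlinL v; omega
  -- the digits of an exponent
  set dig : ℕ → (Fin m × Fin m → ℕ) → ℕ := fun q e =>
    ∑ r, ∑ v ∈ Finset.univ.filter (fun v => G r v = q), e v with hdig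
  have hweight : ∀ e : Fin m × Fin m →₀ ℕ,
      Finsupp.weight (fun v => (μn v : ℤ)) e =
        ((∑ q ∈ Finset.range Q, dig q e * R ^ q : ℕ) : ℤ) := by
    intro e
    rw [bfba_weight_natCast, wH_weight_eq_digitSum G R Q hGQ]
  have hdiglt : ∀ e : Fin m × Fin m →₀ ℕ, e.degree ≤ m → ∀ q, dig q e < R := by
    intro e he q
    have h1 := wH_digit_le G e q
    rw [bfba_sum_eq_degree, Fintype.card_fin] at h1
    simp only [hdig]
    omega
  -- digit at the padding position
  have hdig0 : ∀ e : Fin m × Fin m → ℕ, dig (L + 4 * n) e = 4 * e (0, 0) := by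
    intro e
    have hfil : ∀ r, Finset.univ.filter (fun v => G r v = L + 4 * n) = {(0, 0)} := by
      intro r
      refine Finset.eq_singleton_iff_unique_mem.2
        ⟨Finset.mem_filter.2 ⟨Finset.mem_univ _, hG0 r⟩, fun v hv => ?_⟩
      have hv' := (Finset.mem_filter.1 hv).2
      rcases hGval r v with ⟨I, rfl, h⟩ | ⟨hv0, -⟩ | ⟨-, -, h⟩
      · rw [h] at hv'; have := hgQ r (I r); omega
      · exact hv0
      · rw [h] at hv'; have := hlinL v; omega
    simp only [hdig, hfil, Finset.sum_singleton, Finset.sum_const, Finset.card_univ,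
      Fintype.card_fin, smul_eq_mul]
  -- digit at the position of an unused variable
  have hdigp : ∀ p, p ∉ Set.range ι → p ≠ (0, 0) → ∀ e : Fin m × Fin m → ℕ,
      dig (L - 1 - lin p) e = 4 * e p := by
    intro p hp hp0 e
    have hlp := hlinL p
    have hfil : ∀ r, Finset.univ.filter (fun v => G r v = L - 1 - lin p) = {p} := by
      intro r
      refine Finset.eq_singleton_iff_unique_mem.2
        ⟨Finset.mem_filter.2 ⟨Finset.mem_univ _, hGp r p hp hp0⟩, fun v hv => ?_⟩
      have hv' := (Finset.mem_filter.1 hv).2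
      rcases hGval r v with ⟨I, rfl, h⟩ | ⟨rfl, h⟩ | ⟨-, -, h⟩
      · rw [h] at hv'; simp only [hg] at hv'; omega
      · rw [h] at hv'; omega
      · rw [h] at hv'
        have hlv := hlinL v
        apply bfba_lin_injective
        have h' : lin v = lin p := by omega
        simpa only [hlin] using h'
    simp only [hdig, hfil, Finset.sum_singleton, Finset.sum_const, Finset.card_univ,
      Fintype.card_fin, smul_eq_mul]
  -- digit at a slot position: the slot content
  have hdigg : ∀ (r : Fin 4) (i : Fin n) (e : Fin m × Fin m → ℕ),
      dig (g r i) e = ∑ I ∈ Finset.univ.filter (fun I : Fin 4 → Fin n => I r = i), e (ι I) := by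
    intro r i e
    have hi := i.isLt
    have hr := r.isLt
    -- which `(r', v)` have `G r' v = g r i`: exactly `r' = r`, `v = ι I` with `I r = i`
    have hsolve : ∀ (r' : Fin 4) (v : Fin m × Fin m), G r' v = g r i →
        r' = r ∧ ∃ I : Fin 4 → Fin n, v = ι I ∧ I r = i := by
      intro r' v hv
      have hr' := r'.isLt
      rcases hGval r' v with ⟨I, rfl, h⟩ | ⟨rfl, h⟩ | ⟨-, -, h⟩
      · rw [h] at hv
        have := (I r').isLt
        simp only [hg] at hv
        have hrr : r' = r := Fin.ext (by omega)
        subst hrr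
        exact ⟨rfl, I, rfl, Fin.ext (by omega)⟩
      · rw [h] at hv; have := hgQ r i; omega
      · rw [h] at hv; simp only [hg] at hv; have := hlinL v; omega
    have hfil : ∀ r' : Fin 4, Finset.univ.filter (fun v => G r' v = g r i) =
        if r' = r then (Finset.univ.filter (fun I : Fin 4 → Fin n => I r = i)).image ι else ∅ := by
      intro r'
      split_ifs with hrr
      · subst hrr
        ext v
        simp only [Finset.mem_filter, Finset.mem_univ, true_and, Finset.mem_image]
        constructor
        · intro hv
          obtain ⟨-, I, rfl, hI⟩ := hsolve r' v hv
          exact ⟨I, hI, rfl⟩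
        · rintro ⟨I, hI, rfl⟩
          rw [hGι, hI]
      · exact Finset.filter_eq_empty_iff.2 fun v _ hv => hrr (hsolve r' v hv).1
    simp only [hdig]
    rw [Finset.sum_eq_single r (fun r' _ hr'' => by rw [hfil, if_neg hr'', Finset.sum_empty])
      (fun h => absurd (Finset.mem_univ r) h), hfil, if_pos rfl,
      Finset.sum_image (fun I _ I' _ h => hι h)]
  -- equal weight in degree `≤ m` ⇒ equal content
  have hcontent : ∀ e e' : Fin m × Fin m →₀ ℕ, e.degree ≤ m → e'.degree ≤ m →
      Finsupp.weight (fun v => (μn v : ℤ)) e = Finsupp.weight (fun v => (μn v : ℤ)) e' →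
      (∀ v, v ∉ Set.range ι → e v = e' v) ∧
      (∀ (r : Fin 4) (i : Fin n),
        ∑ I ∈ Finset.univ.filter (fun I : Fin 4 → Fin n => I r = i), e (ι I) =
          ∑ I ∈ Finset.univ.filter (fun I : Fin 4 → Fin n => I r = i), e' (ι I)) := by
    intro e e' he he' hw
    have hdigeq : ∀ q, q < Q → dig q e = dig q e' := by
      refine bfba_digits_inj R hR0 Q (fun q => dig q e) (fun q => dig q e') (hdiglt e he)
        (hdiglt e' he') ?_
      have h := hw
      rw [hweight e, hweight e'] at h
      exact_mod_cast h
    refine ⟨fun v hv => ?_, fun r i => ?_⟩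
    · by_cases hv0 : v = (0, 0)
      · subst hv0
        have h := hdigeq (L + 4 * n) (by omega)
        rw [hdig0, hdig0] at h
        omega
      · have hlv := hlinL v
        have h := hdigeq (L - 1 - lin v) (by omega)
        rw [hdigp v hv hv0, hdigp v hv hv0] at h
        omega
    · have hq : g r i < Q := by
        have := hgQ r i
        omega
      have h := hdigeq (g r i) hq
      rwa [hdigg, hdigg] at h
  refine ⟨fun v => (μn v : ℤ), fun v => Int.natCast_nonneg _, ?_, ?_, ?_, ?_, ?_, ?_, ?_, ?_⟩
  · -- injectivity, from the content of the exponents of `x_v` and `x_{v'}`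
    have hdeg : ∀ u : Fin m × Fin m, (Finsupp.single u 1 : Fin m × Fin m →₀ ℕ).degree ≤ m := by
      intro u
      rw [Finsupp.degree_single]
      exact hm
    refine wH_injective_of_content ι hι _ fun v v' hvv' => hcontent _ _ (hdeg v) (hdeg v') ?_
    rw [Finsupp.weight_single, Finsupp.weight_single, one_smul, one_smul]
    exact hvv'
  · -- anti-dominance (i): lowering an index inside the used block raises `μ`
    intro I I' hle hne
    obtain ⟨r₀, hr₀⟩ := Function.ne_iff.1 hne
    have hle₀ : ((I' r₀ : Fin n) : ℕ) ≤ (I r₀ : ℕ) := hle r₀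
    have hlt₀ : ((I' r₀ : Fin n) : ℕ) < (I r₀ : ℕ) :=
      lt_of_le_of_ne hle₀ (fun h => hr₀ (Fin.ext h).symm)
    show (μn (ι I) : ℤ) < (μn (ι I') : ℤ)
    rw [hμnι, hμnι]
    have key : ∑ r, R ^ g r (I r) < ∑ r, R ^ g r (I' r) := by
      refine Finset.sum_lt_sum (fun r _ => Nat.pow_le_pow_right hR0 ?_)
        ⟨r₀, Finset.mem_univ _, Nat.pow_lt_pow_right hR1 ?_⟩
      · have h1 : ((I' r : Fin n) : ℕ) ≤ (I r : ℕ) := hle r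
        have := (I r).isLt
        simp only [hg]
        omega
      · have := (I r₀).isLt
        simp only [hg]
        omega
    exact_mod_cast key
  · -- anti-dominance (ii): unused variables weigh less than used ones
    intro p hp hp0 I
    show (μn p : ℤ) < (μn (ι I) : ℤ)
    rw [hμnp p hp hp0, hμnι]
    have hlp := hlinL p
    have hpow : 0 < R ^ (L - 1 - lin p) := Nat.pow_pos hR0
    have h1 : 4 * R ^ (L - 1 - lin p) < R ^ L := by
      calc 4 * R ^ (L - 1 - lin p) < R * R ^ (L - 1 - lin p) := by
            have h4 : 4 < R := by omega
            nlinarith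
        _ = R ^ (L - 1 - lin p + 1) := by rw [pow_succ]; ring
        _ ≤ R ^ L := Nat.pow_le_pow_right hR0 (by omega)
    have h2 : R ^ L ≤ ∑ r, R ^ g r (I r) := by
      calc R ^ L ≤ R ^ g 0 (I 0) := Nat.pow_le_pow_right hR0 (by simp only [hg]; omega)
        _ ≤ ∑ r, R ^ g r (I r) :=
          Finset.single_le_sum (f := fun r => R ^ g r (I r)) (fun r _ => Nat.zero_le _)
            (Finset.mem_univ 0)
    exact_mod_cast h1.trans_le h2
  · -- anti-dominance (ii'): unused variables weigh less than the padding variable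
    intro p hp hp0
    show (μn p : ℤ) < (μn (0, 0) : ℤ)
    rw [hμnp p hp hp0, hμn0]
    have hlp := hlinL p
    have key : 4 * R ^ (L - 1 - lin p) < 4 * R ^ (L + 4 * n) :=
      Nat.mul_lt_mul_of_pos_left (Nat.pow_lt_pow_right hR1 (by omega)) (by norm_num)
    exact_mod_cast key
  · -- anti-dominance (iii): among unused variables `μ` decreases with the position
    intro p q hp hp0 hq hq0 hlt
    have hlt' : lin p < lin q := hlt
    show (μn q : ℤ) < (μn p : ℤ)
    rw [hμnp p hp hp0, hμnp q hq hq0]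
    have hlp := hlinL p
    have hlq := hlinL q
    have key : 4 * R ^ (L - 1 - lin q) < 4 * R ^ (L - 1 - lin p) :=
      Nat.mul_lt_mul_of_pos_left (Nat.pow_lt_pow_right hR1 (by omega)) (by norm_num)
    exact_mod_cast key
  · -- the padded four-dimensional determinant is `μ`-homogeneous
    refine wH_padded_hyperdet_weight ι _ (fun r i => ((R ^ g r i : ℕ) : ℤ)) fun I => ?_
    show (μn (ι I) : ℤ) = ∑ r, ((R ^ g r (I r) : ℕ) : ℤ)
    rw [hμnι, Nat.cast_sum]
  · -- genericity: equal weights in degree `≤ m` ⇒ equal content ⇒ equal characters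
    intro e e' he he' hw d _hd ht
    obtain ⟨t, ht⟩ := ht
    obtain ⟨hoff, hslot⟩ := hcontent e e' he he' hw
    exact wH_char_eq_of_content ι hι e e' hoff hslot d t ht
  · -- boundedness
    refine ⟨(m : ℤ) * ∑ v, (μn v : ℤ), fun e he => ?_⟩
    rw [bfba_weight_natCast]
    have h1 : ∑ v, e v * μn v ≤ ∑ v, e v * ∑ u, μn u := by
      refine Finset.sum_le_sum fun v _ => Nat.mul_le_mul_left _ ?_
      exact Finset.single_le_sum (fun u _ => Nat.zero_le (μn u)) (Finset.mem_univ v)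
    rw [← Finset.sum_mul, bfba_sum_eq_degree] at h1
    have h2 : e.degree * ∑ u, μn u ≤ m * ∑ u, μn u := Nat.mul_le_mul_right _ he
    have h3 := h1.trans h2
    exact_mod_cast h3

end Summit.ValiantsHypothesis.ValiantsHypothesis.Theorems.DetQPDetqpThesis

end
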